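import Summits.ValiantsHypothesis.ValiantsHypothesis.Theses.ScaledPencil
import Literature.Computability.AlgebraicComplexity.DeterminantalConormalBoundKernelAlgebra

/-!
# ValiantsHypothesis / ScaledPencil — `PencilOfAffine` (bookkeeping)

Route `ScaledPencil`, item `stmt-ValiantsHypothesis-5322` (support, rank 9): `per_n` has an affine
determinantal representation of size `m` (`HasDetRepr`, a matrix of polynomials of total degree
`≤ 1` with determinant `per_n`; Mignon–Ressayre 2004 §1, Bürgisser 2000 §2.5) iff some pencil datum
`(Λ, L)` of size `m` has `det (Λ + Σ_v x_v L_v) = per_n`.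

* (→) take `Λ = A(0)` (constant coefficients) and `L_v` the coefficient matrix of `x_v`; an entry
  of total degree `≤ 1` is its constant coefficient plus `Σ_v coeff_v · x_v`
  (`DeterminantalConormal.eq_C_add_sum_of_totalDegree_le_one`, tree), so the pencil matrix IS `A`.
* (←) the entries `C (Λ a b) + Σ_v C (L v a b) * X v` have total degree `≤ 1`.

Nothing else is here; the statement is proved for an arbitrary target polynomial first
(`hasDetRepr_iff_exists_pencil`) and then specialised to `per_n`.
-/

namespace Summit.ValiantsHypothesis.ValiantsHypothesis.Theorems

set_option linter.dupNamespace false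

open MvPolynomial

/-- The entries of a pencil matrix `C (Λ a b) + Σ_v C (L v a b) * X v` are affine linear forms
(total degree `≤ 1`). [folklore] -/
theorem totalDegree_pencilEntry_le_one {R : Type*} [CommSemiring R] {σ : Type*} [Fintype σ]
    (c : R) (l : σ → R) :
    (C c + ∑ v, C (l v) * X v : MvPolynomial σ R).totalDegree ≤ 1 := by
  refine (totalDegree_add _ _).trans (max_le ?_ ?_)
  · simp
  · refine (totalDegree_finsetSum _ _).trans (Finset.sup_le fun v _ => ?_)
    refine (totalDegree_mul _ _).trans ?_
    rw [totalDegree_C, zero_add]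
    exact (isHomogeneous_X R v).totalDegree_le

/-- **Pencil form of affine determinantal representations.** For a finite variable type `σ`, a
polynomial `f` has an affine determinantal representation of size `m` iff
`f = det (Λ + Σ_v x_v L_v)` for some `Λ ∈ M_m(R)` and `L : σ → M_m(R)`: an entry of total degree
`≤ 1` is its constant coefficient plus `Σ_v coeff_v · x_v` (Mignon–Ressayre 2004 §1;
Bürgisser 2000 §2.5). [folklore] -/
theorem hasDetRepr_iff_exists_pencil {R : Type*} [CommRing R] {σ : Type*} [Fintype σ]
    (f : MvPolynomial σ R) (m : ℕ) :
    Literature.Computability.AlgebraicComplexity.HasDetRepr f m ↔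
      ∃ (Λ : Matrix (Fin m) (Fin m) R) (L : σ → Matrix (Fin m) (Fin m) R),
        (Matrix.of fun a b => C (Λ a b) + ∑ v : σ, C (L v a b) * X v).det = f := by
  constructor
  · rintro ⟨A, hA, hdet⟩
    refine ⟨A.map (coeff 0), fun v => A.map (coeff (Finsupp.single v 1)), ?_⟩
    have hAeq : (Matrix.of fun a b => C (A.map (coeff 0) a b) +
        ∑ v : σ, C ((fun v => A.map (coeff (Finsupp.single v 1))) v a b) * X v) = A := by
      refine Matrix.ext fun a b => ?_
      simp only [Matrix.of_apply, Matrix.map_apply]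
      exact (Literature.Computability.AlgebraicComplexity.DeterminantalConormal.eq_C_add_sum_of_totalDegree_le_one
        (hA a b)).symm
    rw [hAeq]
    exact hdet
  · rintro ⟨Λ, L, h⟩
    exact ⟨_, fun a b => by simpa only [Matrix.of_apply] using
      totalDegree_pencilEntry_le_one (Λ a b) (fun v => L v a b), h⟩

/-- Settles `stmt-ValiantsHypothesis-5322` (`PencilOfAffine`, route `ScaledPencil`): `per_n` has an
affine determinantal representation of size `m` iff some pencil `(Λ, L)` of size `m` has
`det (Λ + Σ_ij x_ij L_ij) = per_n` — the case `f = per_n`, `σ = Fin n × Fin n`, `R = ℂ` of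
`hasDetRepr_iff_exists_pencil` (Mignon–Ressayre 2004 §1; Bürgisser 2000 §2.5). [folklore] -/
theorem pencilOfAffine_proof :
    Summit.ValiantsHypothesis.ValiantsHypothesis.Theses.ScaledPencil.PencilOfAffine := by
  unfold Summit.ValiantsHypothesis.ValiantsHypothesis.Theses.ScaledPencil.PencilOfAffine
  intro n m
  exact hasDetRepr_iff_exists_pencil _ m

end Summit.ValiantsHypothesis.ValiantsHypothesis.Theorems
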